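import Summits.PneNP.PneNP.Theorems.Sd2BlMachineDictClauses
import Summits.PneNP.PneNP.Theorems.SfmBlMachineGlue
import Summits.PneNP.PneNP.Theorems.Sd2BlMachineGlue

/-!
# K1'' machine side (S3), DICTIONARY D2c: the machine's remainder / spot leg lists through the part labelling

Cell pnp-ideate, ROUND-18 item K1''; twin of the leg-list section of `SfmBlMachineGlue` (pnp-ideate-prover-2 g12) with
`trips ↦ raw`.  The machine selects legs by label (`SfmBlMachine.rlegs plegs labels` = label `0`, `slegs plegs labels s`
= label `s + 1`); the pipeline speaks of the legs with `p e = none` / `p e = some s`.  For `plegs = pieceLegsG L raw`: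
`mem_rlegs_iff_pG` / `mem_slegs_iff_pG` (positions, D2a's `pG`), and over the certificate legs through the bijection
`posOf` of D1i: `mem_rlegs_iff_pI` / `mem_slegs_iff_pI` / `mem_slegs_iff_subtypeI` (D2i's `pI`); `plegI_injective`,
`nodup_slegsI` (the nodup lemmas `nodup_pieceLegsG` / `nodup_slegsG` are prover-2's, `Sd2BlMachineGlue`).  Restricted-model algorithmic infrastructure;
nothing here bears on `P` versus `NP`.
-/

set_option linter.dupNamespace false -- `Summit.PneNP.PneNP.…`: summit = sub-problem name (D-0017 single-conjunct layout)

namespace Summit.PneNP.PneNP.Theorems.Sd2BlMachine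

open Literature.Computability.Complexity
open Summit.PneNP.PneNP.Theorems.SfmBlMachine (Lab PLeg rlegs slegs)
open Summit.PneNP.PneNP.Theorems.SignRepCertificate (Cert)
open Summit.PneNP.PneNP.Theorems.SignDeg2Legs (Kind coef CLeg)
open Summit.PneNP.PneNP.Theorems.LocalMapDecodeFP (decode)

/-! ## Positions -/

section Positions

variable (L : ℕ) (raw : List RLeg)

/-- Membership in a label-selected leg list through positions. -/
theorem mem_filter_zip_iffG {labels : List ℕ} (hlen : labels.length = raw.length) (c : ℕ) (x : PLeg) :
    x ∈ (((labels.zip (pieceLegsG L raw)).filter fun q => decide (q.1 = c)).map Prod.snd)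
      ↔ ∃ e : Fin raw.length, labOfG labels e = c ∧ plegOfG L raw e = x := by
  have hlenP : (pieceLegsG L raw).length = raw.length := length_pieceLegsG L raw
  rw [List.mem_map]
  simp only [List.mem_filter, decide_eq_true_eq]
  constructor
  · rintro ⟨⟨lab, y⟩, ⟨hmem, hlab0⟩, rfl⟩
    simp only at hlab0 ⊢
    obtain ⟨i, hi, hq⟩ := List.mem_iff_getElem.1 hmem
    rw [List.length_zip, hlen, hlenP, min_self] at hi
    rw [List.getElem_zip] at hq
    have h1 := congrArg Prod.fst hq; have h2 := congrArg Prod.snd hq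
    simp only at h1 h2
    refine ⟨⟨i, hi⟩, ?_, ?_⟩
    · unfold labOfG; rw [List.getD_eq_getElem _ _ (by rw [hlen]; exact hi), h1, hlab0]
    · rw [← h2]; unfold plegOfG; rw [pieceLegsG_getElem]
  · rintro ⟨e, he, rfl⟩
    unfold labOfG at he
    rw [List.getD_eq_getElem _ _ (by rw [hlen]; exact e.isLt)] at he
    have hi : e.val < (labels.zip (pieceLegsG L raw)).length := by
      rw [List.length_zip, hlen, hlenP, min_self]; exact e.isLt
    refine ⟨(labels[e.val]'(by rw [hlen]; exact e.isLt), plegOfG L raw e), ⟨?_, he⟩, rfl⟩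
    have := List.getElem_mem hi
    rw [List.getElem_zip, pieceLegsG_getElem] at this
    exact this

/-- **The remainder legs are the records of the positions with `pG = none`.** -/
theorem mem_rlegs_iff_pG {labels : List ℕ} {r : ℕ} (hlab : ∀ lab ∈ labels, lab ≤ r)
    (hlen : labels.length = raw.length) (x : PLeg) :
    x ∈ rlegs (pieceLegsG L raw) labels ↔ ∃ e, pG labels r hlab e = none ∧ plegOfG L raw e = x := by
  unfold rlegs
  rw [mem_filter_zip_iffG L raw hlen 0 x]
  exact exists_congr fun e => by rw [pG_eq_none_iff]

/-- **The legs of spot `s` are the records of the positions with `pG = some s`.** -/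
theorem mem_slegs_iff_pG {labels : List ℕ} {r : ℕ} (hlab : ∀ lab ∈ labels, lab ≤ r)
    (hlen : labels.length = raw.length) (s : Fin r) (x : PLeg) :
    x ∈ slegs (pieceLegsG L raw) labels s.val ↔ ∃ e, pG labels r hlab e = some s ∧ plegOfG L raw e = x := by
  unfold slegs
  rw [mem_filter_zip_iffG L raw hlen (s.val + 1) x]
  exact exists_congr fun e => by rw [pG_eq_some_iff]

end Positions

/-! ## Certificate legs -/

section WithF

variable {k n m : ℕ} (I : LocalMap k n m) (c : Cert I)
  (F0 : ((Fin k → Bool) → Bool) → ℤ) (F1 : ((Fin k → Bool) → Bool) → Fin k → ℤ)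
  (F2 : ((Fin k → Bool) → Bool) → Fin k → Fin k → ℤ)
  (hF : ∀ (j : Fin m) (κ : Kind k), coef c j κ = coefF k F0 F1 F2 (I.table j) κ) (L : ℕ)
include hF

/-- The pieced leg of a certificate leg. -/
noncomputable def plegI (e : CLeg c) : PLeg := plegOfG L (rawI I F0 F1 F2) (posOf I c F0 F1 F2 hF e)

/-- **The remainder legs are the pieced legs of the certificate legs with `pI = none`.** -/
theorem mem_rlegs_iff_pI {labels : List ℕ} {r : ℕ} (hlab : ∀ lab ∈ labels, lab ≤ r)
    (hlen : labels.length = (rawI I F0 F1 F2).length) (x : PLeg) :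
    x ∈ rlegs (pieceLegsG L (rawI I F0 F1 F2)) labels ↔
      ∃ e : CLeg c, pI I c F0 F1 F2 hF labels r hlab e = none ∧ plegI I c F0 F1 F2 hF L e = x := by
  rw [mem_rlegs_iff_pG L _ hlab hlen x]
  constructor
  · rintro ⟨p, hp, rfl⟩
    obtain ⟨e, rfl⟩ := posOf_surjective I c F0 F1 F2 hF p
    exact ⟨e, hp, rfl⟩
  · rintro ⟨e, he, rfl⟩
    exact ⟨posOf I c F0 F1 F2 hF e, he, rfl⟩

/-- **The legs of spot `s` are the pieced legs of the certificate legs with `pI = some s`.** -/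
theorem mem_slegs_iff_pI {labels : List ℕ} {r : ℕ} (hlab : ∀ lab ∈ labels, lab ≤ r)
    (hlen : labels.length = (rawI I F0 F1 F2).length) (s : Fin r) (x : PLeg) :
    x ∈ slegs (pieceLegsG L (rawI I F0 F1 F2)) labels s.val ↔
      ∃ e : CLeg c, pI I c F0 F1 F2 hF labels r hlab e = some s ∧ plegI I c F0 F1 F2 hF L e = x := by
  rw [mem_slegs_iff_pG L _ hlab hlen s x]
  constructor
  · rintro ⟨p, hp, rfl⟩
    obtain ⟨e, rfl⟩ := posOf_surjective I c F0 F1 F2 hF p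
    exact ⟨e, hp, rfl⟩
  · rintro ⟨e, he, rfl⟩
    exact ⟨posOf I c F0 F1 F2 hF e, he, rfl⟩

/-- The same for the subtype of the certificate legs of spot `s`. -/
theorem mem_slegs_iff_subtypeI {labels : List ℕ} {r : ℕ} (hlab : ∀ lab ∈ labels, lab ≤ r)
    (hlen : labels.length = (rawI I F0 F1 F2).length) (s : Fin r) (x : PLeg) :
    x ∈ slegs (pieceLegsG L (rawI I F0 F1 F2)) labels s.val ↔
      ∃ e : {e : CLeg c // pI I c F0 F1 F2 hF labels r hlab e = some s}, plegI I c F0 F1 F2 hF L e.1 = x := by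
  rw [mem_slegs_iff_pI I c F0 F1 F2 hF L hlab hlen s x]
  exact ⟨fun ⟨e, he, hx⟩ => ⟨⟨e, he⟩, hx⟩, fun ⟨e, hx⟩ => ⟨e.1, e.2, hx⟩⟩

/-- `plegI` is injective. -/
theorem plegI_injective : Function.Injective (plegI I c F0 F1 F2 hF L) := by
  intro e e' h
  apply posOf_injective I c F0 F1 F2 hF
  have hnd := nodup_pieceLegsG L (nodup_rawLegs I F0 F1 F2)
  unfold plegI plegOfG at h
  have h1 : (pieceLegsG L (rawI I F0 F1 F2))[(posOf I c F0 F1 F2 hF e).val]'(by rw [length_pieceLegsG]; exact (posOf I c F0 F1 F2 hF e).isLt)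
      = (pieceLegsG L (rawI I F0 F1 F2))[(posOf I c F0 F1 F2 hF e').val]'(by rw [length_pieceLegsG]; exact (posOf I c F0 F1 F2 hF e').isLt) := by
    rw [pieceLegsG_getElem, pieceLegsG_getElem]; exact h
  exact Fin.ext ((hnd.getElem_inj_iff).1 h1)

omit hF in
/-- The legs of a spot have no duplicates. -/
theorem nodup_slegsI (labels : List ℕ) (s : ℕ) : (slegs (pieceLegsG L (rawI I F0 F1 F2)) labels s).Nodup :=
  nodup_slegsG (nodup_pieceLegsG L (nodup_rawLegs I F0 F1 F2)) labels s

/-- Unfolding: the pieced leg of a certificate leg is the pieced leg of its position. -/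
theorem plegI_eq (e : CLeg c) : plegI I c F0 F1 F2 hF L e = plegG L (rawI I F0 F1 F2) (posOf I c F0 F1 F2 hF e).val := rfl

/-- The OUTPUT field of the pieced leg of `e` is `e.out` (the `hO` binder of `SfmBlMachine.sum_spotRecs_eq` / `traceSum`
dictionaries with `φ := plegI`). -/
theorem plegI_out (e : CLeg c) : (plegI I c F0 F1 F2 hF L e).1 = e.out.val := by
  rw [plegI_eq, plegG_out L _ _ (posOf I c F0 F1 F2 hF e).isLt, getElem_posOf I c F0 F1 F2 hF e]
  rfl

/-- The left label of the pieced leg of `e` is the label of its left piece. -/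
theorem labL_plegI (e : CLeg c) : SfmBlMachine.labL (plegI I c F0 F1 F2 hF L e) = (srcI I c F0 F1 F2 hF L e).1 := rfl

/-- The right label of the pieced leg of `e` is the label of its right piece. -/
theorem labR_plegI (e : CLeg c) : SfmBlMachine.labR (plegI I c F0 F1 F2 hF L e) = (dstI I c F0 F1 F2 hF L e).1 := rfl

/-- The pieced leg of `e` is an item of the machine's pieced-leg list. -/
theorem plegI_mem (e : CLeg c) : plegI I c F0 F1 F2 hF L e ∈ pieceLegsG L (rawI I F0 F1 F2) := plegOfG_mem L _ _

end WithF

end Summit.PneNP.PneNP.Theorems.Sd2BlMachine
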